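import Literature.NumberTheory.LFunctions.ThinPlacesEulerProductHalfPlane
import HarnessLib

/-!
# Splitting a partial Euler product along a set of places; pole transfer across the places of degree `≥ 2`

Topic `Literature/NumberTheory/LFunctions`; namespace `Literature.NumberTheory.LFunctions.AbelianDensity`
(sequel of ★ `ThinPlacesEulerProductHalfPlane.lean`).  THEOREMS ONLY (no definition, no instance, no named
fact, no `sorry`).  Cell `pub/hodgecm-mathlib` (crux H413 = `stmt-HodgeConjecture-24833`), P2 toe-hold L5′
«PARTIAL EULER PRODUCT SPLITTING» of ROAD-W v1 §2 W4 (the bookkeeping step «`L^S = `(product over the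
degree-one places) × (product over the places of degree `≥ 2`)» used by the W4 pole files
`Theorems/F0P2wPartialDedekindZetaPole.lean` ∕ the theta-shape pole file of F0P2-p01 (g20)); count-neutral.

THE STATEMENTS.  §1 For any Satake family `α` (★ `SatakeFamily`), any set of places `S` and any set of
places `P`: if the Euler products `L^{S ∪ Pᶜ}(s, α)` (over the places of `P` outside `S`) and
`L^{S ∪ P}(s, α)` (over the places outside `S ∪ P`) converge to `a` and `b`, then the Euler product
`L^S(s, α)` converges to `a · b` (`hasProd_partialStandardL_split`), so
`L^S(s, α) = L^{S ∪ Pᶜ}(s, α) · L^{S ∪ P}(s, α)` whenever both converge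
(`partialStandardL_eq_mul_of_multipliable`) — Mathlib `HasProd.mul_compl` on the index type `{v // v ∉ S}`
along `{v | v.1 ∈ P}`, the two pieces identified with the index types of the two partial products by
explicit `Equiv`s.  With `P = {v : N(v) prime}` (`hasProd_partialStandardL_split_prime`, complement spelled
`{v | ¬ N(v) prime}`) and ★ `hasProd_partialStandardL_of_prime_mem` ∕ ★
`hasProd_partialStandardL_of_norm_le_rpow` this is the W4 decomposition «degree-one part × thin part»
`L^S = L^{S ∪ {N(v) not prime}} · L^{S ∪ {N(v) prime}}` on `re s > θ + 1` for parameters `‖a‖ ≤ q_v^θ`,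
`#(α v) ≤ n` (`partialStandardL_eq_degOne_mul_thin`) [HeilbronnZetaL1967, Ch. VIII §2, Thm. 5 (PDF p. 251) and Note after Thm. 5 (PDF p. 252):
the Euler product of `L(s, χ)` split into the degree-one primes and the rest].  §2 The trivial family
`𝟙 = (v ↦ {1})`: its local factor is `1 - q_v^{-s}` (`eval_eulerPolynomial_one`), it has one parameter of
norm `≤ q_v^0` (`card_one_le`, `norm_le_rpow_zero_of_mem_one`), and
`L^S(s, 𝟙) = ∏'_{v ∉ S} (1 - q_v^{-s})⁻¹` (`partialStandardL_one_eq`) — literally the partial Dedekind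
zeta product of ★ `tendsto_sub_one_mul_tprod_eulerFactor_one_numberField` ∕ ★
`hasProd_dedekindEulerFactor_holds` [NeukirchANT1999, Ch. VII (5.2)].  §3 **Pole transfer** — ROAD-W W4's
«the places of degree `≥ 2` may stay unknown» made kernel (`exists_eq_sub_mul_partialStandardL_of_degOne`):
if `#(α v) ≤ n` off `S₀`, `‖a‖ ≤ q_v^{θ₁}` at the degree-one places and `‖a‖ ≤ q_v^θ` at the other places
off `S₀`, and `(s - s₀) · L^{S₀ ∪ {N(v) not prime}}(s, α) = G(s)` on `re s > re s₀` with `G` holomorphic on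
an open `U ∋ s₀`, `U ⊆ {θ + 1/2 < re}` (`θ + 1/2 < re s₀`, `θ₁ + 1 ≤ re s₀`), then
`(s - s₀) · L^{S₀}(s, α) = G′(s)` on `re s > re s₀` with `G′ = G · T` holomorphic on `U`, `T = L^{S₀ ∪ {N(v)
prime}}(·, α)` the thin product, `T(s₀) ≠ 0`, and `(s - s₀) · L^{S₀}(s, α) → G(s₀) · T(s₀)` on
`𝓝[re > re s₀] s₀`; for W4 (`s₀ = 3/2`, theta shape `θ₁ = 1/2`) ANY bound `θ < 1` at the unknown places
suffices — it reduces the pole of `L^{S₀}(s, π × μ′⁻¹)` at `3/2` to that of the degree-one product (pen: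
F0P2-p01 (g20), `Theorems/F0P2wPartialDedekindZetaPole.lean` and sequel).

HONEST SCOPE.  HC_CM is proved only modulo the 7 printed citations (2 remaining: hLiu418 =
stmt-HodgeConjecture-24832, h413 = stmt-HodgeConjecture-24833) until rung 0 closes; this file is a
count-neutral analytic helper (no printed statement of the summit is discharged here).

## References
* [HeilbronnZetaL1967] H. Heilbronn, *Zeta-functions and L-functions*, Ch. VIII of Cassels–Fröhlich,
  *Algebraic Number Theory* (1967), §2, Thm. 5 (PDF p. 251) and the Note after Thm. 5 (PDF p. 252).
* [NeukirchANT1999] J. Neukirch, *Algebraic Number Theory* (1999), Ch. VII (5.2) (Euler product of `ζ_K`).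
-/

noncomputable section

open Filter Topology NumberField IsDedekindDomain Complex
open Literature.NumberTheory.Automorphic

open scoped Classical

namespace Literature.NumberTheory.LFunctions.AbelianDensity

variable {K : Type} [Field K] [NumberField K]

/-! ## §1 Splitting a partial Euler product along a set of places -/

/-- **Splitting an Euler product along a set of places.**  If the Euler products of `α` off `S ∪ Pᶜ`
(the places of `P` outside `S`) and off `S ∪ P` (the places outside `S ∪ P`) converge to `a` and `b`,
then the Euler product off `S` converges to `a · b` (Mathlib `HasProd.mul_compl` on the index type
`{v // v ∉ S}` along `{v | v ∈ P}`). [cite: HeilbronnZetaL1967, Ch. VIII §2, Thm. 5 (PDF p. 251) and Note after Thm. 5 (PDF p. 252)] -/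
theorem hasProd_partialStandardL_split {S P : Set (HeightOneSpectrum (𝓞 K))} {α : SatakeFamily K}
    {s a b : ℂ}
    (ha : HasProd (fun v : {v : HeightOneSpectrum (𝓞 K) // v ∉ S ∪ Pᶜ} =>
      ((eulerPolynomial (α v.1)).eval ((v.1.residueCard : ℂ) ^ (-s)))⁻¹) a)
    (hb : HasProd (fun v : {v : HeightOneSpectrum (𝓞 K) // v ∉ S ∪ P} =>
      ((eulerPolynomial (α v.1)).eval ((v.1.residueCard : ℂ) ^ (-s)))⁻¹) b) :
    HasProd (fun v : {v : HeightOneSpectrum (𝓞 K) // v ∉ S} =>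
      ((eulerPolynomial (α v.1)).eval ((v.1.residueCard : ℂ) ^ (-s)))⁻¹) (a * b) := by
  set f : {v : HeightOneSpectrum (𝓞 K) // v ∉ S} → ℂ := fun v =>
    ((eulerPolynomial (α v.1)).eval ((v.1.residueCard : ℂ) ^ (-s)))⁻¹ with hf
  set s₀ : Set {v : HeightOneSpectrum (𝓞 K) // v ∉ S} := {v | v.1 ∈ P} with hs₀
  -- the two pieces of the index type, identified with the index types of the two partial products
  let e₁ : ↥s₀ ≃ {v : HeightOneSpectrum (𝓞 K) // v ∉ S ∪ Pᶜ} :=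
    { toFun := fun x => ⟨x.1.1, by
        rintro (h | h)
        · exact x.1.2 h
        · exact h x.2⟩
      invFun := fun v => ⟨⟨v.1, fun h => v.2 (Or.inl h)⟩, by_contra fun h => v.2 (Or.inr h)⟩
      left_inv := fun x => rfl
      right_inv := fun v => rfl }
  let e₂ : ↥(s₀ᶜ) ≃ {v : HeightOneSpectrum (𝓞 K) // v ∉ S ∪ P} :=
    { toFun := fun x => ⟨x.1.1, by
        rintro (h | h)
        · exact x.1.2 h
        · exact x.2 h⟩
      invFun := fun v => ⟨⟨v.1, fun h => v.2 (Or.inl h)⟩, fun h => v.2 (Or.inr h)⟩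
      left_inv := fun x => rfl
      right_inv := fun v => rfl }
  have ha' : HasProd (f ∘ (↑) : ↥s₀ → ℂ) a := by
    have h := (e₁.hasProd_iff (f := fun v : {v : HeightOneSpectrum (𝓞 K) // v ∉ S ∪ Pᶜ} =>
      ((eulerPolynomial (α v.1)).eval ((v.1.residueCard : ℂ) ^ (-s)))⁻¹)).2 ha
    exact h
  have hb' : HasProd (f ∘ (↑) : ↥(s₀ᶜ) → ℂ) b := by
    have h := (e₂.hasProd_iff (f := fun v : {v : HeightOneSpectrum (𝓞 K) // v ∉ S ∪ P} =>
      ((eulerPolynomial (α v.1)).eval ((v.1.residueCard : ℂ) ^ (-s)))⁻¹)).2 hb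
    exact h
  exact ha'.mul_compl hb'

/-- Hence `L^S(s, α) = L^{S ∪ Pᶜ}(s, α) · L^{S ∪ P}(s, α)` whenever the two Euler products on the right
converge. [cite: HeilbronnZetaL1967, Ch. VIII §2, Thm. 5 (PDF p. 251) and Note after Thm. 5 (PDF p. 252)] -/
theorem partialStandardL_eq_mul_of_multipliable {S P : Set (HeightOneSpectrum (𝓞 K))}
    {α : SatakeFamily K} {s : ℂ}
    (ha : Multipliable fun v : {v : HeightOneSpectrum (𝓞 K) // v ∉ S ∪ Pᶜ} =>
      ((eulerPolynomial (α v.1)).eval ((v.1.residueCard : ℂ) ^ (-s)))⁻¹)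
    (hb : Multipliable fun v : {v : HeightOneSpectrum (𝓞 K) // v ∉ S ∪ P} =>
      ((eulerPolynomial (α v.1)).eval ((v.1.residueCard : ℂ) ^ (-s)))⁻¹) :
    partialStandardL S α s = partialStandardL (S ∪ Pᶜ) α s * partialStandardL (S ∪ P) α s :=
  (hasProd_partialStandardL_split ha.hasProd hb.hasProd).tprod_eq

/-- **Splitting along the residue degree** (`P = {v : N(v) prime}`, complement spelled `{v | ¬ N(v) prime}`):
if the Euler products of `α` over the degree-one places off `S` and over the places of degree `≥ 2` off `S`
converge to `a` and `b`, the Euler product off `S` converges to `a · b`.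
[cite: HeilbronnZetaL1967, Ch. VIII §2, Thm. 5 (PDF p. 251) and Note after Thm. 5 (PDF p. 252)] -/
theorem hasProd_partialStandardL_split_prime {S : Set (HeightOneSpectrum (𝓞 K))} {α : SatakeFamily K}
    {s a b : ℂ}
    (ha : HasProd (fun v : {v : HeightOneSpectrum (𝓞 K) // v ∉ S ∪ {v | ¬ (Ideal.absNorm v.asIdeal).Prime}} =>
      ((eulerPolynomial (α v.1)).eval ((v.1.residueCard : ℂ) ^ (-s)))⁻¹) a)
    (hb : HasProd (fun v : {v : HeightOneSpectrum (𝓞 K) // v ∉ S ∪ {v | (Ideal.absNorm v.asIdeal).Prime}} =>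
      ((eulerPolynomial (α v.1)).eval ((v.1.residueCard : ℂ) ^ (-s)))⁻¹) b) :
    HasProd (fun v : {v : HeightOneSpectrum (𝓞 K) // v ∉ S} =>
      ((eulerPolynomial (α v.1)).eval ((v.1.residueCard : ℂ) ^ (-s)))⁻¹) (a * b) :=
  hasProd_partialStandardL_split (S := S) (α := α) (s := s)
    (P := {v : HeightOneSpectrum (𝓞 K) | (Ideal.absNorm v.asIdeal).Prime}) ha hb

/-- **The W4 decomposition «degree-one part × thin part».**  If the parameters of `α` off `S` satisfy
`#(α v) ≤ n` and `‖a‖ ≤ q_v^θ`, then on `re s > θ + 1` (where all three Euler products converge, ★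
`hasProd_partialStandardL_of_norm_le_rpow`, ★ `hasProd_partialStandardL_of_prime_mem`)
`L^S(s, α) = L^{S ∪ {v : N(v) not prime}}(s, α) · L^{S ∪ {v : N(v) prime}}(s, α)`.
[cite: HeilbronnZetaL1967, Ch. VIII §2, Thm. 5 (PDF p. 251) and Note after Thm. 5 (PDF p. 252)] -/
theorem partialStandardL_eq_degOne_mul_thin {S : Set (HeightOneSpectrum (𝓞 K))} {α : SatakeFamily K}
    {θ : ℝ} {n : ℕ} (hcard : ∀ v, v ∉ S → Multiset.card (α v) ≤ n)
    (hα : ∀ v, v ∉ S → ∀ a ∈ α v, ‖a‖ ≤ (v.residueCard : ℝ) ^ θ) {s : ℂ} (hs : θ + 1 < s.re) :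
    partialStandardL S α s =
      partialStandardL (S ∪ {v | ¬ (Ideal.absNorm v.asIdeal).Prime}) α s *
        partialStandardL (S ∪ {v | (Ideal.absNorm v.asIdeal).Prime}) α s := by
  have ha := hasProd_partialStandardL_of_norm_le_rpow
    (S := S ∪ {v | ¬ (Ideal.absNorm v.asIdeal).Prime}) (α := α) (θ := θ) (n := n)
    (fun v hv => hcard v fun h => hv (Or.inl h)) (fun v hv => hα v fun h => hv (Or.inl h)) hs
  have hb := hasProd_partialStandardL_of_prime_mem (S := S ∪ {v | (Ideal.absNorm v.asIdeal).Prime})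
    (fun v hv => Or.inr hv) (α := α) (θ := θ) (n := n)
    (fun v hv => hcard v fun h => hv (Or.inl h)) (fun v hv => hα v fun h => hv (Or.inl h))
    (s := s) (by linarith)
  exact (hasProd_partialStandardL_split_prime ha hb).tprod_eq

/-! ## §2 The trivial Satake family: partial Dedekind zeta functions -/

/-- The local factor of the trivial family `v ↦ {1}` is `1 - q_v^{-s}`. [cite: NeukirchANT1999, Ch. VII (5.2)] -/
theorem eval_eulerPolynomial_one (x : ℂ) : (eulerPolynomial ({1} : Multiset ℂ)).eval x = 1 - x := by
  rw [eval_eulerPolynomial, Multiset.map_singleton, Multiset.prod_singleton, one_mul]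

omit [NumberField K] in
/-- The trivial family has one parameter at every place. [cite: NeukirchANT1999, Ch. VII (5.2)] -/
theorem card_one_le (v : HeightOneSpectrum (𝓞 K)) :
    Multiset.card ((fun _ : HeightOneSpectrum (𝓞 K) => ({1} : Multiset ℂ)) v) ≤ 1 := by
  simp

/-- The trivial family has parameters of norm `≤ q_v^0 = 1`. [cite: NeukirchANT1999, Ch. VII (5.2)] -/
theorem norm_le_rpow_zero_of_mem_one (v : HeightOneSpectrum (𝓞 K)) (a : ℂ)
    (ha : a ∈ (fun _ : HeightOneSpectrum (𝓞 K) => ({1} : Multiset ℂ)) v) :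
    ‖a‖ ≤ (v.residueCard : ℝ) ^ (0 : ℝ) := by
  have ha1 : a = 1 := by simpa using ha
  rw [ha1, norm_one, Real.rpow_zero]

/-- **The partial Dedekind zeta function `ζ_K^S(s) = ∏'_{v ∉ S} (1 - q_v^{-s})⁻¹` is `L^S(s, 𝟙)`** for the
trivial family `𝟙 = (v ↦ {1})`. [cite: NeukirchANT1999, Ch. VII (5.2)] -/
theorem partialStandardL_one_eq (S : Set (HeightOneSpectrum (𝓞 K))) (s : ℂ) :
    partialStandardL S (fun _ => ({1} : Multiset ℂ)) s =
      ∏' v : {v : HeightOneSpectrum (𝓞 K) // v ∉ S}, (1 - ((v.1.residueCard : ℂ) ^ (-s)))⁻¹ := by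
  simp only [partialStandardL, eval_eulerPolynomial_one]

/-! ## §3 Pole transfer across the places of degree `≥ 2` (ROAD-W W4 «may stay unknown») -/

/-- **Pole transfer across the thin places.**  Let `α` have `#(α v) ≤ n` off `S₀`, parameters of norm
`≤ q_v^{θ₁}` at the degree-one places off `S₀` and of norm `≤ q_v^θ` at the other places off `S₀` (the
«unknown» places of ROAD-W W4), and let `s₀` be a point with `θ + 1/2 < re s₀` and `θ₁ + 1 ≤ re s₀`.  If on
the half-plane `re s > re s₀` the DEGREE-ONE Euler product satisfies
`(s - s₀) · L^{S₀ ∪ {v : N(v) not prime}}(s, α) = G(s)` with `G` holomorphic on an open `U ∋ s₀`,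
`U ⊆ {θ + 1/2 < re}`, then the FULL Euler product off `S₀` satisfies `(s - s₀) · L^{S₀}(s, α) = G′(s)` there
with `G′ = G · L^{S₀ ∪ {v : N(v) prime}}(·, α)` holomorphic on `U` and `G′(s₀) = G(s₀) · T(s₀)`, `T(s₀) ≠ 0`
(★ `differentiableOn_partialStandardL_of_prime_mem`: the thin product `T` is holomorphic and non-zero on
`re s > θ + 1/2`; §1 splitting on `re s > re s₀`).  So a simple pole (`G(s₀) ≠ 0`) or a regular value of the
degree-one product at `s₀` is the same for the full product: the places of degree `≥ 2` may stay unknown up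
to the bound `θ < re s₀ - 1/2` (for W4: `s₀ = 3/2`, any `θ < 1`).
[cite: HeilbronnZetaL1967, Ch. VIII §2, Thm. 5 (PDF p. 251) and Note after Thm. 5 (PDF p. 252)] -/
theorem exists_eq_sub_mul_partialStandardL_of_degOne {S₀ : Set (HeightOneSpectrum (𝓞 K))}
    {α : SatakeFamily K} {θ θ₁ : ℝ} {n : ℕ}
    (hcard : ∀ v, v ∉ S₀ → Multiset.card (α v) ≤ n)
    (hα : ∀ v, v ∉ S₀ → ¬ (Ideal.absNorm v.asIdeal).Prime → ∀ a ∈ α v, ‖a‖ ≤ (v.residueCard : ℝ) ^ θ)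
    (hα₁ : ∀ v, v ∉ S₀ → (Ideal.absNorm v.asIdeal).Prime → ∀ a ∈ α v, ‖a‖ ≤ (v.residueCard : ℝ) ^ θ₁)
    {s₀ : ℂ} (hθ : θ + 1 / 2 < s₀.re) (hθ₁ : θ₁ + 1 ≤ s₀.re)
    {U : Set ℂ} (hUo : IsOpen U) (hs₀ : s₀ ∈ U) (hU : U ⊆ {s : ℂ | θ + 1 / 2 < s.re})
    {G : ℂ → ℂ} (hG : DifferentiableOn ℂ G U)
    (hGeq : ∀ s : ℂ, s₀.re < s.re →
      (s - s₀) * partialStandardL (S₀ ∪ {v | ¬ (Ideal.absNorm v.asIdeal).Prime}) α s = G s) :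
    ∃ G' : ℂ → ℂ, DifferentiableOn ℂ G' U ∧
      G' s₀ = G s₀ * partialStandardL (S₀ ∪ {v | (Ideal.absNorm v.asIdeal).Prime}) α s₀ ∧
      partialStandardL (S₀ ∪ {v | (Ideal.absNorm v.asIdeal).Prime}) α s₀ ≠ 0 ∧
      (∀ s : ℂ, s₀.re < s.re → (s - s₀) * partialStandardL S₀ α s = G' s) ∧
      Tendsto (fun s : ℂ => (s - s₀) * partialStandardL S₀ α s) (𝓝[{s : ℂ | s₀.re < s.re}] s₀)
        (𝓝 (G s₀ * partialStandardL (S₀ ∪ {v | (Ideal.absNorm v.asIdeal).Prime}) α s₀)) := by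
  -- the thin product `T` off `S₀`: holomorphic and non-zero on `re s > θ + 1/2`
  have hSP : ∀ v : HeightOneSpectrum (𝓞 K), (Ideal.absNorm v.asIdeal).Prime →
      v ∈ S₀ ∪ {v | (Ideal.absNorm v.asIdeal).Prime} := fun v hv => Or.inr hv
  have hcardT : ∀ v, v ∉ S₀ ∪ {v | (Ideal.absNorm v.asIdeal).Prime} → Multiset.card (α v) ≤ n :=
    fun v hv => hcard v fun h => hv (Or.inl h)
  have hαT : ∀ v, v ∉ S₀ ∪ {v | (Ideal.absNorm v.asIdeal).Prime} → ∀ a ∈ α v,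
      ‖a‖ ≤ (v.residueCard : ℝ) ^ θ :=
    fun v hv => hα v (fun h => hv (Or.inl h)) (fun h => hv (Or.inr h))
  have hT := differentiableOn_partialStandardL_of_prime_mem hSP hcardT hαT
  have hT0 : partialStandardL (S₀ ∪ {v | (Ideal.absNorm v.asIdeal).Prime}) α s₀ ≠ 0 := hT.2 s₀ hθ
  -- the splitting `L^{S₀} = L^{S₀ ∪ {N(v) not prime}} · T` on `re s > re s₀`
  have hsplit : ∀ s : ℂ, s₀.re < s.re → partialStandardL S₀ α s =
      partialStandardL (S₀ ∪ {v | ¬ (Ideal.absNorm v.asIdeal).Prime}) α s *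
        partialStandardL (S₀ ∪ {v | (Ideal.absNorm v.asIdeal).Prime}) α s := by
    intro s hs
    have ha := hasProd_partialStandardL_of_norm_le_rpow
      (S := S₀ ∪ {v | ¬ (Ideal.absNorm v.asIdeal).Prime}) (α := α) (θ := θ₁) (n := n)
      (fun v hv => hcard v fun h => hv (Or.inl h))
      (fun v hv => hα₁ v (fun h => hv (Or.inl h)) (by_contra fun h => hv (Or.inr h)))
      (s := s) (by linarith)
    have hb := hasProd_partialStandardL_of_prime_mem hSP (α := α) (θ := θ) (n := n) hcardT hαT
      (s := s) (by linarith)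
    exact (hasProd_partialStandardL_split_prime ha hb).tprod_eq
  refine ⟨fun s => G s * partialStandardL (S₀ ∪ {v | (Ideal.absNorm v.asIdeal).Prime}) α s,
    hG.mul (hT.1.mono hU), rfl, hT0, fun s hs => ?_, ?_⟩
  · rw [hsplit s hs, ← mul_assoc, hGeq s hs]
  · -- the `Tendsto` reading: `G · T` is continuous at `s₀`
    have hc : ContinuousAt
        (fun s => G s * partialStandardL (S₀ ∪ {v | (Ideal.absNorm v.asIdeal).Prime}) α s) s₀ :=
      ((hG.mul (hT.1.mono hU)).differentiableAt (hUo.mem_nhds hs₀)).continuousAt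
    refine (hc.tendsto.mono_left nhdsWithin_le_nhds).congr' ?_
    refine eventually_nhdsWithin_of_forall fun s hs => ?_
    have hs' : s₀.re < s.re := hs
    show G s * partialStandardL (S₀ ∪ {v | (Ideal.absNorm v.asIdeal).Prime}) α s =
      (s - s₀) * partialStandardL S₀ α s
    rw [hsplit s hs', ← mul_assoc, hGeq s hs']

end Literature.NumberTheory.LFunctions.AbelianDensity

end
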